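import Summits.RiemannHypothesis.RiemannHypothesis.Theorems.SuzukiStructureFunctionsPhiSpaceDerivative
import HarnessLib

/-!
# SuzukiStructureFunctionsPhiSystem — the `L²` form of Lemma 3.6 and Suzuki's first-order system (3.24)/(3.25)
# `(∂_t + εμ(t))φ^ε(t,x) = ∂_xφ^{−ε}(t,x)`, PROVED for every `C¹` kernel vanishing on `(−∞,0]`, every clean
# `t ∈ (0,τ)` and every real `x` (column DBR; RH-FREE)

LINE 1 — LABEL: RH-FREE (calculus + Fredholm uniqueness on `L²(ℝ)` for ANY `C¹` kernel vanishing on `(−∞,0]`; no `ζ`,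
no zeros, no positivity); bears_on LADDER-RH B-D → B-P(P1)/(P3): §3.5's system (3.25) is the engine of Prop. 3.2
((3.30)) and hence of Thm. 3.1 (4) (the canonical system) — the remaining conjunct of the typed residual
`SuzukiStructure.Suzuki2021_thm31_dynamics`; with …PhiTimeDerivative/…PhiSpaceDerivative this file closes §3.4–§3.5
for `C¹` kernels (e.g. `K_ζ^{ω,ν}`, `νω > 2`, by …ZetaRegularity).
WHAT THIS IS NOT: not progress toward RH; Prop. 3.2 ((3.30)) and Thm. 3.1 (4) are NOT proved here; nothing is claimed
for kernels that are only piecewise `C¹`.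

Source: M. Suzuki, J. Funct. Anal. 281 (2021) 109116 = arXiv:1606.05726 [Suzuki2021Hamiltonians], §3.4 Lemma 3.6,
§3.5 eqs. (3.20)–(3.25).

Contents (seat rh-dbr-eng-5 g7): **`hasDerivAt_suzukiPhiExt_memLp`** (Lemma 3.6 for `K ∈ C¹`, with
`∂_tφ^ε(t,·)|_{(−t,t)} ∈ L²`), **`suzuki_first_order_system`** ((3.24) as a `HasDerivAt` in `t`),
`deriv_time_add_mu_mul_eq_deriv_space` ((3.25)).
-/

noncomputable section

-- D-0017: `Summit.<S>.<S>.…` is the designed namespace of a single-problem summit.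
set_option linter.dupNamespace false

open MeasureTheory Set Filter Topology Function
open scoped ENNReal RealInnerProductSpace

namespace Summit.RiemannHypothesis.RiemannHypothesis.Theorems.SuzukiStructureFunctions

open Literature.Analysis.OperatorTheory Literature.NumberTheory.LFunctions
  Literature.NumberTheory.LFunctions.SuzukiStructure
open Summit.RiemannHypothesis.RiemannHypothesis.Theorems.SuzukiPhiExistence
  (continuous_suzukiPhiExt setIntegral_Iic_kernel_mul_suzukiPhiExt_eq exists_isSuzukiPhiSolution_of_noUnitEigenvalue)

variable {K : ℝ → ℝ} {ε t : ℝ}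

/-! ## §26 Suzuki's first-order system (3.24)/(3.25) for `K ∈ C¹`:
`∂_tφ^ε(t,x) − ∂_xφ^{−ε}(t,x) = −εμ(t)φ^ε(t,x)` at every `x`, every clean `t ∈ (0,τ)` -/

/-- **RH-FREE · LEMMA 3.6 for `K ∈ C¹`, `L²` form:** as `hasDerivAt_suzukiPhiExt` (…PhiTimeDerivative), and in
addition the `t`-derivative `ψ = ∂_tφ^ε(t,·)` is square-integrable on the window `(−t,t)` — so that its equation
(3.20) is a genuine Fredholm equation there (the resolvent gives `ψ|_{(−t,t)} ∈ L²`). -/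
theorem hasDerivAt_suzukiPhiExt_memLp (hKd : ContDiff ℝ 1 K) (hK0 : ∀ u : ℝ, u ≤ 0 → K u = 0)
    (hε : ε = 1 ∨ ε = -1) {τ : ℝ} (hclean : ∀ s : ℝ, s ∈ Ico 0 τ → NoUnitEigenvalue K s) (ht : t ∈ Ioo 0 τ) :
    ∃ ψ : ℝ → ℝ, MemLp ψ 2 (volume.restrict (Ioo (-t) t)) ∧
      (∀ x : ℝ, ψ x + ε * ∫ y in Ioo (-t) t, K (x + y) * ψ y = deriv K (x + t) - ε * suzukiPhiExt K ε t t * K (x + t)) ∧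
      ∀ x : ℝ, HasDerivAt (fun s : ℝ => suzukiPhiExt K ε s x) (ψ x) t := by
  have ht0 : 0 ≤ t := ht.1.le
  have hN : NoUnitEigenvalue K t := hclean t ⟨ht0, ht.2⟩
  have hKc : Continuous K := hKd.continuous
  have hK3 : ∀ u : ℝ, u < 0 → K u = 0 := fun u hu => hK0 u hu.le
  have hsol_t : ∃ X, IsSuzukiPhiSolution K ε t X := exists_isSuzukiPhiSolution_of_noUnitEigenvalue hKc hK0 hε hN
  obtain ⟨G, hGdef⟩ : ∃ G : ℝ → ℝ → ℝ, G = fun s y : ℝ => ∫ θ in (0:ℝ)..1, (deriv K (y + t + θ * (s - t)) -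
      ε * (K (y + (t + θ * (s - t))) * suzukiPhiExt K ε t (t + θ * (s - t)) +
        K (y + (-t - θ * (s - t))) * suzukiPhiExt K ε t (-t - θ * (s - t)))) := ⟨_, rfl⟩
  have hGc : Continuous (uncurry G) := by rw [hGdef]; exact continuous_uncurry_diffQuotKernel hKd hK0 ε t
  -- rows as inner products
  have hrow : ∀ (s x : ℝ) (v : Lp ℝ 2 (volume : Measure ℝ)) (f : ℝ → ℝ),
      ((v : ℝ → ℝ) =ᵐ[volume] fun y => (Icc (-s) s).indicator f y) →
      ⟪(memLp_indicator_window (continuous_uncurry_kernel_row hKc x) s).toLp _, v⟫ =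
        ∫ y in Ioo (-s) s, K (x + y) * f y := by
    intro s x v f hv
    have hg : MemLp (fun y : ℝ => (Icc (-s) s).indicator (fun y => K (x + y)) y) 2 (volume : Measure ℝ) :=
      memLp_indicator_window (continuous_uncurry_kernel_row hKc x) s
    rw [← integral_l2Kernel_mul_eq_inner (K := fun _ y : ℝ => (Icc (-s) s).indicator (fun y => K (x + y)) y)
      (x := x) hg v]
    rw [← setIntegral_congr_set (Ioo_ae_eq_Icc (μ := (volume : Measure ℝ))).symm,
      ← integral_indicator measurableSet_Icc]
    refine integral_congr_ae ?_
    filter_upwards [hv] with y hy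
    rw [hy]
    by_cases hyI : y ∈ Icc (-s) s
    · rw [indicator_of_mem hyI, indicator_of_mem hyI, indicator_of_mem hyI]
    · rw [indicator_of_notMem hyI, indicator_of_notMem hyI, zero_mul, indicator_of_notMem hyI]
  have hUapply : ∀ (s : ℝ) (v : Lp ℝ 2 (volume : Measure ℝ)),
      (((1 + ε • winOpL2 K hKc s) v : Lp ℝ 2 (volume : Measure ℝ)) : ℝ → ℝ) =ᵐ[volume]
        fun x => v x + ε * ∫ y, winKer K s x y * (v : ℝ → ℝ) y := by
    intro s v
    have e : (1 + ε • winOpL2 K hKc s) v = v + ε • winOpL2 K hKc s v := by simp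
    rw [e]
    filter_upwards [Lp.coeFn_add v (ε • winOpL2 K hKc s v), Lp.coeFn_smul ε (winOpL2 K hKc s v),
      winOpL2_spec hKc s v] with x hx1 hx2 hx3
    rw [hx1, Pi.add_apply, hx2, Pi.smul_apply, smul_eq_mul, hx3]
  -- the slope function of …PhiTimeDerivative, rebuilt to read off the window class of `ψ`
  set Q : ℝ → ℝ → ℝ := fun s x => G s x - ε * ⟪(memLp_indicator_window (continuous_uncurry_kernel_row hKc x) s).toLp _,
      Ring.inverse (1 + ε • winOpL2 K hKc s) ((memLp_indicator_window hGc s).toLp _)⟫ with hQ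
  -- (i) continuity at `t` within the clean windows
  have hQc : ∀ x : ℝ, ContinuousWithinAt (fun s : ℝ => Q s x) {s : ℝ | 0 ≤ s ∧ NoUnitEigenvalue K s} t := by
    intro x
    have h1 : Continuous fun s : ℝ => G s x := hGc.comp (by fun_prop : Continuous fun s : ℝ => (s, x))
    have h2 := (continuousOn_toLp_indicator_window (continuous_uncurry_kernel_row hKc x)) t ht0
    have h3 := (continuousOn_toLp_indicator_window hGc) t ht0
    have h4 := continuousWithinAt_inverse_winOpL2 hKc hε ht0 hN
    have h5 := h4.clm_apply h3
    exact (h1.continuousWithinAt.sub (((h2.inner h5).const_smul ε).congr (fun s _ => by simp [smul_eq_mul])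
      (by simp [smul_eq_mul]))).mono fun s hs => hs.1
  -- (ii) the difference identity
  have hQd : ∀ s : ℝ, 0 ≤ s → NoUnitEigenvalue K s → ∀ x : ℝ,
      suzukiPhiExt K ε s x - suzukiPhiExt K ε t x = (s - t) * Q s x := by
    intro s hs0 hNs x
    have hsol_s : ∃ X, IsSuzukiPhiSolution K ε s X := exists_isSuzukiPhiSolution_of_noUnitEigenvalue hKc hK0 hε hNs
    set U : Lp ℝ 2 (volume : Measure ℝ) →L[ℝ] Lp ℝ 2 (volume : Measure ℝ) := 1 + ε • winOpL2 K hKc s with hU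
    have hUu : IsUnit U := isUnit_one_add_smul_winOpL2 hKc hε hNs
    have hDc : Continuous (uncurry fun _ y : ℝ => suzukiPhiExt K ε s y - suzukiPhiExt K ε t y) :=
      ((continuous_suzukiPhiExt hKc hK3 ε s).sub (continuous_suzukiPhiExt hKc hK3 ε t)).comp continuous_snd
    set d : Lp ℝ 2 (volume : Measure ℝ) := (memLp_indicator_window hDc s).toLp _ with hd
    set q : Lp ℝ 2 (volume : Measure ℝ) := (memLp_indicator_window hGc s).toLp _ with hq
    have hd_ae : (d : ℝ → ℝ) =ᵐ[volume]
        fun y => (Icc (-s) s).indicator (fun y => suzukiPhiExt K ε s y - suzukiPhiExt K ε t y) y :=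
      MemLp.coeFn_toLp _
    have hq_ae : (q : ℝ → ℝ) =ᵐ[volume] fun y => (Icc (-s) s).indicator (fun y => G s y) y := MemLp.coeFn_toLp _
    have hDeq : ∀ x : ℝ, (suzukiPhiExt K ε s x - suzukiPhiExt K ε t x) +
        ε * ∫ y in Ioo (-s) s, K (x + y) * (suzukiPhiExt K ε s y - suzukiPhiExt K ε t y) = (s - t) * G s x := by
      intro x; rw [hGdef]; exact suzukiPhiExt_sub_eq hKd hK0 hsol_s hsol_t hs0 ht0 x
    have hUd : U d = (s - t) • q := by
      apply Lp.ext
      filter_upwards [hUapply s d, hd_ae, Lp.coeFn_smul (s - t) q, hq_ae] with x e1 e3 e4 e5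
      rw [e1, e4, Pi.smul_apply, smul_eq_mul, e5]
      have hint : ∫ y, winKer K s x y * (d : ℝ → ℝ) y =
          ∫ y, winKer K s x y * (Icc (-s) s).indicator (fun y => suzukiPhiExt K ε s y - suzukiPhiExt K ε t y) y :=
        integral_congr_ae (by filter_upwards [hd_ae] with y hy; rw [hy])
      rw [hint]
      by_cases hx : x ∈ Icc (-s) s
      · rw [e3, indicator_of_mem hx, indicator_of_mem hx, integral_winKer_mul_eq_setIntegral K hx]
        have hIoo : ∫ y in Ioo (-s) s, K (x + y) *
            (Icc (-s) s).indicator (fun y => suzukiPhiExt K ε s y - suzukiPhiExt K ε t y) y =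
            ∫ y in Ioo (-s) s, K (x + y) * (suzukiPhiExt K ε s y - suzukiPhiExt K ε t y) :=
          setIntegral_congr_fun measurableSet_Ioo fun y hy => by rw [indicator_of_mem (Ioo_subset_Icc_self hy)]
        rw [hIoo]
        exact hDeq x
      · rw [e3, indicator_of_notMem hx, indicator_of_notMem hx, integral_winKer_mul_eq_zero K hx]
        ring
    have hdR : d = (s - t) • Ring.inverse U q := by
      calc d = (Ring.inverse U * U) d := by rw [Ring.inverse_mul_cancel U hUu]; rfl
        _ = Ring.inverse U (U d) := rfl
        _ = (s - t) • Ring.inverse U q := by rw [hUd, map_smul]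
    have e := hDeq x
    rw [← hrow s x d _ hd_ae, hdR, real_inner_smul_right] at e
    simp only [hQ]
    linear_combination e
  -- (iii)+(iv): the resolvent solution at time `t`
  set U : Lp ℝ 2 (volume : Measure ℝ) →L[ℝ] Lp ℝ 2 (volume : Measure ℝ) := 1 + ε • winOpL2 K hKc t with hU
  have hUu : IsUnit U := isUnit_one_add_smul_winOpL2 hKc hε hN
  set q : Lp ℝ 2 (volume : Measure ℝ) := (memLp_indicator_window hGc t).toLp _ with hq
  have hq_ae : (q : ℝ → ℝ) =ᵐ[volume] fun y => (Icc (-t) t).indicator (fun y => G t y) y := MemLp.coeFn_toLp _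
  set w : Lp ℝ 2 (volume : Measure ℝ) := Ring.inverse U q with hw
  have hUw : U w = q := by
    change (U * Ring.inverse U) q = q
    rw [Ring.mul_inverse_cancel U hUu]; rfl
  have hw_ae : ∀ᵐ x ∂(volume : Measure ℝ),
      (w : ℝ → ℝ) x + ε * ∫ y, winKer K t x y * (w : ℝ → ℝ) y = (Icc (-t) t).indicator (fun y => G t y) x := by
    have h1 := hUapply t w
    rw [hUw] at h1
    filter_upwards [h1, hq_ae] with x e1 e2
    rw [← e1, e2]
  have hroww : ∀ x : ℝ, ⟪(memLp_indicator_window (continuous_uncurry_kernel_row hKc x) t).toLp _, w⟫ =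
      ∫ y in Ioo (-t) t, K (x + y) * (w : ℝ → ℝ) y := by
    intro x
    refine hrow t x w (w : ℝ → ℝ) ?_
    filter_upwards [hw_ae] with y hy
    by_cases hyI : y ∈ Icc (-t) t
    · rw [indicator_of_mem hyI]
    · rw [indicator_of_notMem hyI]
      rw [indicator_of_notMem hyI, integral_winKer_mul_eq_zero K hyI, mul_zero, add_zero] at hy
      exact hy
  have hwψ : ∀ᵐ y ∂(volume.restrict (Ioo (-t) t)), (w : ℝ → ℝ) y = Q t y := by
    rw [ae_restrict_iff' measurableSet_Ioo]
    filter_upwards [hw_ae] with y hy hyI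
    rw [indicator_of_mem (Ioo_subset_Icc_self hyI),
      integral_winKer_mul_eq_setIntegral K (Ioo_subset_Icc_self hyI)] at hy
    simp only [hQ]
    rw [hroww y]
    linarith
  have hmem : MemLp (fun y : ℝ => Q t y) 2 (volume.restrict (Ioo (-t) t)) :=
    ((Lp.memLp w).restrict (Ioo (-t) t)).ae_eq hwψ
  have hGt : ∀ x : ℝ, G t x = deriv K (x + t) - ε * suzukiPhiExt K ε t t * K (x + t) := by
    intro x
    rw [hGdef]
    simp only [sub_self, mul_zero, add_zero, sub_zero, intervalIntegral.integral_const, one_smul,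
      suzukiPhiExt_neg_self hK0 hsol_t]
    ring
  have hQe : ∀ x : ℝ, Q t x + ε * ∫ y in Ioo (-t) t, K (x + y) * Q t y =
      deriv K (x + t) - ε * suzukiPhiExt K ε t t * K (x + t) := by
    intro x
    have hI : ∫ y in Ioo (-t) t, K (x + y) * (w : ℝ → ℝ) y = ∫ y in Ioo (-t) t, K (x + y) * Q t y :=
      integral_congr_ae (by filter_upwards [hwψ] with y hy; rw [← hy])
    rw [← hI, ← hroww x, ← hGt x]
    simp only [hQ]
    ring
  -- assemble
  refine ⟨fun x => Q t x, hmem, hQe, fun x => ?_⟩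
  rw [hasDerivAt_iff_tendsto_slope]
  have hS : {s : ℝ | 0 ≤ s ∧ NoUnitEigenvalue K s} ∈ 𝓝 t := by
    filter_upwards [Ioo_mem_nhds ht.1 ht.2] with s hs
    exact ⟨hs.1.le, hclean s ⟨hs.1.le, hs.2⟩⟩
  have hc : ContinuousAt (fun s : ℝ => Q s x) t := (hQc x).continuousAt hS
  have h2 : Tendsto (fun s : ℝ => Q s x) (𝓝[≠] t) (𝓝 (Q t x)) := hc.tendsto.mono_left nhdsWithin_le_nhds
  refine h2.congr' ?_
  have hev : ∀ᶠ s in 𝓝[≠] t, s ∈ Ioo 0 τ := mem_nhdsWithin_of_mem_nhds (Ioo_mem_nhds ht.1 ht.2)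
  filter_upwards [hev, self_mem_nhdsWithin] with s hs hne
  have hne' : s - t ≠ 0 := sub_ne_zero.2 hne
  rw [slope_def_field, hQd s hs.1.le (hclean s ⟨hs.1.le, hs.2⟩) x, mul_div_cancel_left₀ _ hne']

/-- **RH-FREE · SUZUKI'S FIRST-ORDER SYSTEM (3.24)/(3.25), PROVED for `K ∈ C¹(ℝ)` vanishing on `(−∞,0]`:** on a clean
range `[0,τ)`, for every `t ∈ (0,τ)` and EVERY real `x`,
`∂_tφ^ε(t,x) − ∂_xφ^{−ε}(t,x) = −εμ(t)φ^ε(t,x)`, `μ(t) = φ⁺(t,t) + φ⁻(t,t)` — i.e.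
`(∂_t + εμ(t))φ^ε(t,x) = ∂_xφ^{−ε}(t,x)`. Proof as in §3.5: `∂_tφ^ε` solves (3.20), `∂_xφ^{−ε}` solves (3.21), so
their difference and `−εμφ^ε` solve the same window equation; uniqueness ((K5) at `t`). -/
theorem suzuki_first_order_system (hKd : ContDiff ℝ 1 K) (hK0 : ∀ u : ℝ, u ≤ 0 → K u = 0) (hε : ε = 1 ∨ ε = -1)
    {τ : ℝ} (hclean : ∀ s : ℝ, s ∈ Ico 0 τ → NoUnitEigenvalue K s) (ht : t ∈ Ioo 0 τ) (x : ℝ) :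
    HasDerivAt (fun s : ℝ => suzukiPhiExt K ε s x)
      (deriv (suzukiPhiExt K (-ε) t) x - ε * mu K t * suzukiPhiExt K ε t x) t := by
  have ht0 : 0 ≤ t := ht.1.le
  have hN : NoUnitEigenvalue K t := hclean t ⟨ht0, ht.2⟩
  have hKc : Continuous K := hKd.continuous
  have hK3 : ∀ u : ℝ, u < 0 → K u = 0 := fun u hu => hK0 u hu.le
  have hε' : -ε = 1 ∨ -ε = -1 := by
    rcases hε with h | h
    · exact Or.inr (by rw [h])
    · exact Or.inl (by rw [h]; norm_num)
  have hsol : ∃ X, IsSuzukiPhiSolution K ε t X := exists_isSuzukiPhiSolution_of_noUnitEigenvalue hKc hK0 hε hN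
  have hsol' : ∃ X, IsSuzukiPhiSolution K (-ε) t X := exists_isSuzukiPhiSolution_of_noUnitEigenvalue hKc hK0 hε' hN
  obtain ⟨ψ, hψmem, hψeq, hψd⟩ := hasDerivAt_suzukiPhiExt_memLp hKd hK0 hε hclean ht
  set φ := suzukiPhiExt K ε t with hφdef
  set χ := deriv (suzukiPhiExt K (-ε) t) with hχdef
  have hφc : Continuous φ := continuous_suzukiPhiExt hKc hK3 ε t
  have hχc : Continuous χ := continuous_deriv_suzukiPhiExt_space hKd hK0 hsol' ht0
  -- (3.21) for `−ε`
  have h321 : ∀ x : ℝ, χ x + ε * ∫ y in Ioo (-t) t, K (x + y) * χ y =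
      deriv K (x + t) + ε * suzukiPhiExt K (-ε) t t * K (x + t) := by
    intro x
    have h := deriv_space_window_eq hKd hK0 hsol' ht0 x
    rw [← hχdef] at h
    linear_combination h
  -- (3.8) for `φ`
  have h38 : ∀ x : ℝ, φ x + ε * ∫ y in Ioo (-t) t, K (x + y) * φ y = K (x + t) := by
    intro x
    rw [hφdef, ← setIntegral_Iic_kernel_mul_suzukiPhiExt_eq hK3 ε t x]
    have := suzukiPhiExt_eq hsol x
    linarith
  -- `μ(t) = φ^ε(t,t) + φ^{−ε}(t,t)`
  have hmu : mu K t = suzukiPhiExt K ε t t + suzukiPhiExt K (-ε) t t := by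
    rw [mu_def]
    rcases hε with h | h
    · rw [h]
    · rw [h, neg_neg, add_comm]
  -- integrability on the window
  haveI : IsFiniteMeasure (volume.restrict (Ioo (-t) t)) :=
    ⟨by rw [Measure.restrict_apply_univ]; exact measure_Ioo_lt_top⟩
  have hKrow : ∀ x' : ℝ, Continuous fun y : ℝ => K (x' + y) := fun x' => hKc.comp (continuous_const.add continuous_id)
  have hiψ : ∀ x' : ℝ, Integrable (fun y : ℝ => K (x' + y) * ψ y) (volume.restrict (Ioo (-t) t)) := by
    intro x'
    obtain ⟨CK, hCK⟩ : ∃ C, ∀ u ∈ Icc (-(|x'| + |t|)) (|x'| + |t|), ‖K u‖ ≤ C :=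
      isCompact_Icc.exists_bound_of_continuousOn hKc.continuousOn
    refine (hψmem.integrable one_le_two).bdd_mul (c := CK) ((hKrow x').aestronglyMeasurable) ?_
    rw [ae_restrict_iff' measurableSet_Ioo]
    refine Eventually.of_forall fun y hy => hCK _ ⟨?_, ?_⟩
    · linarith [hy.1, hy.2, le_abs_self x', neg_abs_le x', le_abs_self t, neg_abs_le t]
    · linarith [hy.1, hy.2, le_abs_self x', neg_abs_le x', le_abs_self t, neg_abs_le t]
  have hiχ : ∀ x' : ℝ, Integrable (fun y : ℝ => K (x' + y) * χ y) (volume.restrict (Ioo (-t) t)) := fun x' =>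
    (((hKrow x').mul hχc).integrableOn_Icc).mono_set Ioo_subset_Icc_self
  have hiφ : ∀ x' : ℝ, Integrable (fun y : ℝ => K (x' + y) * φ y) (volume.restrict (Ioo (-t) t)) := fun x' =>
    (((hKrow x').mul hφc).integrableOn_Icc).mono_set Ioo_subset_Icc_self
  -- `g = ψ − χ + εμφ` solves the homogeneous window equation
  have hg : ∀ x' : ℝ, (ψ x' - χ x' + ε * mu K t * φ x') +
      ε * ∫ y in Ioo (-t) t, K (x' + y) * (ψ y - χ y + ε * mu K t * φ y) = 0 := by
    intro x'
    have hsplit : ∫ y in Ioo (-t) t, K (x' + y) * (ψ y - χ y + ε * mu K t * φ y) =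
        (∫ y in Ioo (-t) t, K (x' + y) * ψ y) - (∫ y in Ioo (-t) t, K (x' + y) * χ y) +
          ε * mu K t * ∫ y in Ioo (-t) t, K (x' + y) * φ y := by
      rw [← integral_sub (hiψ x') (hiχ x'), ← integral_const_mul, ← integral_add]
      · refine integral_congr_ae (Eventually.of_forall fun y => ?_)
        simp only
        ring
      · exact (hiψ x').sub (hiχ x')
      · exact (hiφ x').const_mul _
    rw [hsplit, hmu]
    have e1 := hψeq x'
    have e2 := h321 x'
    have e3 := h38 x'
    linear_combination e1 - e2 + ε * (suzukiPhiExt K ε t t + suzukiPhiExt K (-ε) t t) * e3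
  have hgmem : MemLp (fun y : ℝ => ψ y - χ y + ε * mu K t * φ y) 2 (volume.restrict (Ioo (-t) t)) :=
    (hψmem.sub (memLp_window_of_continuous hχc t)).add ((memLp_window_of_continuous hφc t).const_mul (ε * mu K t))
  have hg0 : ψ x - χ x + ε * mu K t * φ x = 0 := eq_zero_of_window_eq_zero hKc hε hN hgmem hg x
  exact (hψd x).congr_deriv (by linarith)

/-- RH-FREE. (3.25) with `deriv`: `∂_tφ^ε(t,x) + εμ(t)φ^ε(t,x) = ∂_xφ^{−ε}(t,x)` (`K ∈ C¹`, clean `t ∈ (0,τ)`, all `x`). -/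
theorem deriv_time_add_mu_mul_eq_deriv_space (hKd : ContDiff ℝ 1 K) (hK0 : ∀ u : ℝ, u ≤ 0 → K u = 0)
    (hε : ε = 1 ∨ ε = -1) {τ : ℝ} (hclean : ∀ s : ℝ, s ∈ Ico 0 τ → NoUnitEigenvalue K s) (ht : t ∈ Ioo 0 τ)
    (x : ℝ) :
    deriv (fun s : ℝ => suzukiPhiExt K ε s x) t + ε * mu K t * suzukiPhiExt K ε t x =
      deriv (suzukiPhiExt K (-ε) t) x := by
  rw [(suzuki_first_order_system hKd hK0 hε hclean ht x).deriv]
  ring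

end Summit.RiemannHypothesis.RiemannHypothesis.Theorems.SuzukiStructureFunctions
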